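import Mathlib.Analysis.SpecialFunctions.Trigonometric.DerivHyp
import Literature.Probability.RandomPlanarGeometry.CrossRatioContinuity
import Literature.Probability.RandomPlanarGeometry.CardyFunction
import Literature.Probability.RandomPlanarGeometry.ChordalCurveFamily
import HarnessLib

/-!
# Stub `stub_exactFromApproximate` of line `birth`, crux `SegmentTransport` (stmt-CriticalPhenomena-11199)

Route `ModulusResponse` of `CriticalPhenomena/CardyFormulaZ2`. The EXACTNESS UPGRADE by compactness in
the stretch parameter, for an ARBITRARY set function `P : Set ℂ → ℝ → Set ℂ → Set ℂ → ℝ` (no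
probability): if for every `ε > 0` some pinned diagonal stretch `S_t`, `t ∈ [-T, T]`
(`S_t z = cosh t · z + i sinh t · z̄`), makes `δ ↦ P (S_t R) δ` eventually `ε`-close to `F(η(R))` for
every conformal rectangle `R` and every uniformizing datum, then ONE stretch `t⋆` gives
`R.HasCrossingLimit (P (S_{t⋆} R) ·) F` for every `R`.

Proof. Choose `t n ∈ [-T, T]` good at level `1/(n+1)`; Bolzano–Weierstrass gives `t (φ n) → t⋆`.
Fix `R` and a uniformizing datum `(φ', x)` of `R`; with `s n = t⋆ - t (φ n) → 0` and plane
homeomorphisms `h n` acting as `S_{s n}`, the image rectangles `R_n = S_{s n}(R)` satisfy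
`S_{t (φ n)} '' R_n = S_{t⋆} '' R` (carrier and arcs; group law `S_a ∘ S_b = S_{a+b}`), so the
hypothesis at `(t (φ n), R_n)` controls the SAME numbers `P (S_{t⋆} R) δ` up to `1/(φ n + 1)`, with
target `F(η(R_n))`. By Radó (`ConformalRectangle.tendsto_crossRatio_of_tendstoUniformly`; the boundary
loops `S_{s n} ∘ ∂R` converge uniformly to `∂R` and the marked points converge) `η(R_n) → η(R)`, and
`F` is continuous on `(0, 1)` (`continuousOn_cardyFunction_Ioo`); an `ε/2 + ε/2` argument concludes.

The helper lemmas on the stretches (sub-namespace `Exact`) are copies of the lead's shared helper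
file `work/Stretch.lean` of this line (pure plane geometry of the pinned stretches).
-/

noncomputable section

open Set Filter Metric Complex
open scoped Topology ComplexConjugate
open UpperHalfPlane (upperHalfPlaneSet)
open Literature.Probability.RandomPlanarGeometry

namespace Summit.CriticalPhenomena.CardyFormulaZ2.Cruxes.SegmentTransport.Birth

namespace Exact

variable (S : ℝ → ℂ → ℂ)
  (hS : ∀ t z, S t z = (Real.cosh t : ℂ) * z + Complex.I * (Real.sinh t : ℂ) * (starRingEnd ℂ) z)
include hS

/-- Real part of the stretch: `re (S_t z) = cosh t · re z + sinh t · im z`. -/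
theorem stretch_re (t : ℝ) (z : ℂ) : (S t z).re = Real.cosh t * z.re + Real.sinh t * z.im := by
  rw [hS]
  simp only [Complex.add_re, Complex.mul_re, Complex.mul_im, Complex.ofReal_re, Complex.ofReal_im,
    Complex.I_re, Complex.I_im, Complex.conj_re, Complex.conj_im]
  ring

/-- Imaginary part of the stretch: `im (S_t z) = cosh t · im z + sinh t · re z`. -/
theorem stretch_im (t : ℝ) (z : ℂ) : (S t z).im = Real.cosh t * z.im + Real.sinh t * z.re := by
  rw [hS]
  simp only [Complex.add_im, Complex.mul_re, Complex.mul_im, Complex.ofReal_re, Complex.ofReal_im,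
    Complex.I_re, Complex.I_im, Complex.conj_re, Complex.conj_im]
  ring

/-- `S_0 = id`. -/
theorem stretch_zero (z : ℂ) : S 0 z = z := by
  apply Complex.ext
  · rw [stretch_re S hS]; simp
  · rw [stretch_im S hS]; simp

/-- **Group law** `S_a (S_b z) = S_{a+b} z` (addition formulas for `cosh` and `sinh`). -/
theorem stretch_add (a b : ℝ) (z : ℂ) : S a (S b z) = S (a + b) z := by
  apply Complex.ext
  · rw [stretch_re S hS, stretch_re S hS, stretch_im S hS, stretch_re S hS, Real.cosh_add,
      Real.sinh_add]
    ring
  · rw [stretch_im S hS, stretch_re S hS, stretch_im S hS, stretch_im S hS, Real.cosh_add,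
      Real.sinh_add]
    ring

/-- `S_t` is continuous. -/
theorem continuous_stretch (t : ℝ) : Continuous (S t) := by
  have h : S t = fun z ↦ (Real.cosh t : ℂ) * z + Complex.I * (Real.sinh t : ℂ) * (starRingEnd ℂ) z :=
    funext (hS t)
  rw [h]
  exact (continuous_const.mul continuous_id).add (continuous_const.mul Complex.continuous_conj)

/-- `t ↦ S_t z` is continuous. -/
theorem continuous_stretch_param (z : ℂ) : Continuous fun t : ℝ ↦ S t z := by
  have h : (fun t : ℝ ↦ S t z) =
      fun t ↦ (Real.cosh t : ℂ) * z + Complex.I * (Real.sinh t : ℂ) * (starRingEnd ℂ) z :=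
    funext fun t ↦ hS t z
  rw [h]
  exact ((Complex.continuous_ofReal.comp Real.continuous_cosh).mul continuous_const).add
    ((continuous_const.mul (Complex.continuous_ofReal.comp Real.continuous_sinh)).mul
      continuous_const)

/-- **The stretch is a homeomorphism of the plane**: there is `h : ℂ ≃ₜ ℂ` acting as `S_t` (its
inverse acts as `S_{-t}`; stated existentially so that this file declares no new objects). -/
theorem exists_stretchHomeomorph (t : ℝ) : ∃ h : ℂ ≃ₜ ℂ, ⇑h = S t :=
  ⟨{ toFun := S t
     invFun := S (-t)
     left_inv := fun z ↦ by
       show S (-t) (S t z) = z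
       rw [stretch_add S hS, neg_add_cancel, stretch_zero S hS]
     right_inv := fun z ↦ by
       show S t (S (-t) z) = z
       rw [stretch_add S hS, add_neg_cancel, stretch_zero S hS]
     continuous_toFun := continuous_stretch S hS t
     continuous_invFun := continuous_stretch S hS (-t) }, rfl⟩

/-- **Image identity** `S_a '' (S_b '' X) = S_{a+b} '' X`. -/
theorem image_stretch_image (a b : ℝ) (X : Set ℂ) : S a '' (S b '' X) = S (a + b) '' X := by
  rw [Set.image_image]
  exact congrArg (fun f : ℂ → ℂ ↦ f '' X) (funext fun z ↦ stretch_add S hS a b z)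

/-! ### Image conformal rectangles -/

omit hS in
/-- The carrier of `S_t(R)` is `S_t '' R.carrier`. -/
theorem carrier_map_stretch (R : ConformalRectangle) {h : ℂ ≃ₜ ℂ} {t : ℝ} (hh : ⇑h = S t) :
    (R.map h).carrier = S t '' R.carrier := by
  rw [MarkedDomain.carrier_map, hh]

omit hS in
/-- The arcs of `S_t(R)` are the images of the arcs of `R`. -/
theorem arc_map_stretch (R : ConformalRectangle) {h : ℂ ≃ₜ ℂ} {t : ℝ} (hh : ⇑h = S t) (i : Fin 4) :
    (R.map h).arc i = S t '' R.arc i := by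
  rw [MarkedDomain.arc_map, hh]

omit hS in
/-- The marked points of `S_t(R)` are the images of the marked points of `R`. -/
theorem pt_map_stretch (R : ConformalRectangle) {h : ℂ ≃ₜ ℂ} {t : ℝ} (hh : ⇑h = S t) (i : Fin 4) :
    (R.map h).pt i = S t (R.pt i) := by
  rw [MarkedDomain.pt_map, hh]

omit hS in
/-- The boundary loop of `S_t(R)` is `S_t ∘ ∂R`. -/
theorem boundary_map_stretch (R : ConformalRectangle) {h : ℂ ≃ₜ ℂ} {t : ℝ} (hh : ⇑h = S t) :
    (R.map h).boundary = S t ∘ R.boundary := by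
  show ⇑h ∘ R.boundary = S t ∘ R.boundary
  rw [hh]

/-- At `t = 0` the boundary loop of `S_0(R)` is that of `R`. -/
theorem boundary_map_stretch_zero (R : ConformalRectangle) {h : ℂ ≃ₜ ℂ} (hh : ⇑h = S 0) :
    (R.map h).boundary = R.boundary := by
  rw [boundary_map_stretch S R hh]
  exact funext fun u ↦ stretch_zero S hS _

/-- At `t = 0` the marked points of `S_0(R)` are those of `R`. -/
theorem pt_map_stretch_zero (R : ConformalRectangle) {h : ℂ ≃ₜ ℂ} (hh : ⇑h = S 0) (i : Fin 4) :
    (R.map h).pt i = R.pt i := by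
  rw [pt_map_stretch S R hh, stretch_zero S hS]

/-- Composition of stretches on image rectangles: `S_a '' (S_b(R)).carrier = S_{a+b} '' R.carrier`. -/
theorem image_carrier_map_stretch (R : ConformalRectangle) {h : ℂ ≃ₜ ℂ} {b : ℝ} (hh : ⇑h = S b)
    (a : ℝ) : S a '' (R.map h).carrier = S (a + b) '' R.carrier := by
  rw [carrier_map_stretch S R hh, image_stretch_image S hS]

/-- Composition of stretches on image arcs: `S_a '' (S_b(R)).arc i = S_{a+b} '' R.arc i`. -/
theorem image_arc_map_stretch (R : ConformalRectangle) {h : ℂ ≃ₜ ℂ} {b : ℝ} (hh : ⇑h = S b)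
    (a : ℝ) (i : Fin 4) : S a '' (R.map h).arc i = S (a + b) '' R.arc i := by
  rw [arc_map_stretch S R hh, image_stretch_image S hS]

/-! ### Dependence on the parameter -/

/-- `S_a z - S_b z = (cosh a - cosh b) z + i (sinh a - sinh b) z̄`. -/
theorem stretch_sub_stretch (a b : ℝ) (z : ℂ) :
    S a z - S b z = ((Real.cosh a - Real.cosh b : ℝ) : ℂ) * z +
      Complex.I * ((Real.sinh a - Real.sinh b : ℝ) : ℂ) * (starRingEnd ℂ) z := by
  rw [hS, hS]
  push_cast
  ring

/-- **Lipschitz dependence on the parameter**: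
`‖S_a z - S_b z‖ ≤ (|cosh a - cosh b| + |sinh a - sinh b|) ‖z‖`. -/
theorem norm_stretch_sub_stretch_le (a b : ℝ) (z : ℂ) :
    ‖S a z - S b z‖ ≤ (|Real.cosh a - Real.cosh b| + |Real.sinh a - Real.sinh b|) * ‖z‖ := by
  rw [stretch_sub_stretch S hS]
  refine (norm_add_le _ _).trans (le_of_eq ?_)
  rw [norm_mul, Complex.norm_real, Real.norm_eq_abs, norm_mul, norm_mul, Complex.norm_I, one_mul,
    Complex.norm_real, Real.norm_eq_abs, Complex.norm_conj]
  ring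

omit hS in
/-- The coefficient `|cosh (s n) - cosh s₀| + |sinh (s n) - sinh s₀|` tends to `0` when `s n → s₀`. -/
theorem tendsto_coeff_of_tendsto {s : ℕ → ℝ} {s₀ : ℝ} (hs : Tendsto s atTop (𝓝 s₀)) :
    Tendsto (fun n ↦ |Real.cosh (s n) - Real.cosh s₀| + |Real.sinh (s n) - Real.sinh s₀|)
      atTop (𝓝 0) := by
  have h1 : Tendsto (fun n ↦ Real.cosh (s n) - Real.cosh s₀) atTop (𝓝 0) := by
    have := (Real.continuous_cosh.tendsto s₀).comp hs
    simpa using this.sub_const (Real.cosh s₀)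
  have h2 : Tendsto (fun n ↦ Real.sinh (s n) - Real.sinh s₀) atTop (𝓝 0) := by
    have := (Real.continuous_sinh.tendsto s₀).comp hs
    simpa using this.sub_const (Real.sinh s₀)
  simpa using h1.abs.add h2.abs

/-- **Uniform convergence of the stretched boundary loops**: if `s n → s₀` then the boundary loops
of `S_{s n}(R)` converge uniformly to that of `S_{s₀}(R)` (the loop `∂R` is bounded). -/
theorem tendstoUniformly_boundary_map_stretch (R : ConformalRectangle) {s : ℕ → ℝ} {s₀ : ℝ}
    (hs : Tendsto s atTop (𝓝 s₀)) {h : ℕ → ℂ ≃ₜ ℂ} (hh : ∀ n, ⇑(h n) = S (s n)) {h₀ : ℂ ≃ₜ ℂ}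
    (hh₀ : ⇑h₀ = S s₀) :
    TendstoUniformly (fun n ↦ (R.map (h n)).boundary) (R.map h₀).boundary atTop := by
  have hb : Bornology.IsBounded (range R.boundary) := by
    rw [R.range_boundary]
    exact R.isBounded.closure.subset frontier_subset_closure
  obtain ⟨M, hM, hMb⟩ := hb.exists_pos_norm_le
  rw [Metric.tendstoUniformly_iff]
  intro ε hε
  have hev := (tendsto_order.1 (tendsto_coeff_of_tendsto hs)).2 (ε / M) (div_pos hε hM)
  filter_upwards [hev] with n hn
  intro u
  rw [boundary_map_stretch S R (hh n), boundary_map_stretch S R hh₀]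
  show dist (S s₀ (R.boundary u)) (S (s n) (R.boundary u)) < ε
  rw [dist_eq_norm]
  calc ‖S s₀ (R.boundary u) - S (s n) (R.boundary u)‖
      ≤ (|Real.cosh s₀ - Real.cosh (s n)| + |Real.sinh s₀ - Real.sinh (s n)|) * ‖R.boundary u‖ :=
        norm_stretch_sub_stretch_le S hS _ _ _
    _ ≤ (|Real.cosh (s n) - Real.cosh s₀| + |Real.sinh (s n) - Real.sinh s₀|) * M := by
        rw [abs_sub_comm (Real.cosh s₀), abs_sub_comm (Real.sinh s₀)]
        exact mul_le_mul_of_nonneg_left (hMb _ (mem_range_self u)) (by positivity)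
    _ < ε / M * M := mul_lt_mul_of_pos_right hn hM
    _ = ε := div_mul_cancel₀ ε hM.ne'

/-- **Convergence of the stretched marked points**: if `s n → s₀` then the marked points of
`S_{s n}(R)` converge to those of `S_{s₀}(R)`. -/
theorem tendsto_pt_map_stretch (R : ConformalRectangle) {s : ℕ → ℝ} {s₀ : ℝ}
    (hs : Tendsto s atTop (𝓝 s₀)) {h : ℕ → ℂ ≃ₜ ℂ} (hh : ∀ n, ⇑(h n) = S (s n)) {h₀ : ℂ ≃ₜ ℂ}
    (hh₀ : ⇑h₀ = S s₀) (i : Fin 4) :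
    Tendsto (fun n ↦ (R.map (h n)).pt i) atTop (𝓝 ((R.map h₀).pt i)) := by
  have e : (fun n ↦ (R.map (h n)).pt i) = fun n ↦ S (s n) (R.pt i) :=
    funext fun n ↦ pt_map_stretch S R (hh n) i
  rw [e, pt_map_stretch S R hh₀]
  exact ((continuous_stretch_param S hS (R.pt i)).tendsto s₀).comp hs

end Exact

/-- **Exact linear-image Cardy from approximate, by compactness in the stretch (pure conformal
geometry; `P` is an ARBITRARY set function `(Ω, δ, A, B) ↦ P Ω δ A B`).** If for every `ε > 0` some
stretch `t ∈ [-T, T]` makes `δ ↦ P (S_t R) δ` eventually `ε`-close to `F(η(R))` for every conformal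
rectangle `R` and every uniformizing datum, then ONE stretch `t⋆` gives
`R.HasCrossingLimit (P (S_{t⋆} R) ·) F` for every `R`. Proof: `t_{1/(n+1)} → t⋆` along a subsequence
(Bolzano–Weierstrass); `S_{t_n}(S_{t⋆-t_n} R) = S_{t⋆} R` as marked sets (group law
`S_a ∘ S_b = S_{a+b}`, image rectangle `R.map`); the cross-ratios of `S_s R` tend to that of `R` as
`s → 0` (Radó: `ConformalRectangle.tendsto_crossRatio_of_tendstoUniformly`); `F` is continuous on
`(0,1)` (`continuousOn_cardyFunction_Ioo`, `crossRatio_mem_Ioo_of_isUniformizing`). -/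
theorem stub_exactFromApproximate :
    ∀ (P : Set ℂ → ℝ → Set ℂ → Set ℂ → ℝ) (S : ℝ → ℂ → ℂ), (∀ t z, S t z = (Real.cosh t : ℂ) * z + Complex.I * (Real.sinh t : ℂ) * (starRingEnd ℂ) z) → ∀ T : ℝ, (∀ ε : ℝ, 0 < ε → ∃ t ∈ Set.Icc (-T) T, ∀ (R : Literature.Probability.RandomPlanarGeometry.ConformalRectangle) (φ : Literature.Probability.RandomPlanarGeometry.ConformalEquiv UpperHalfPlane.upperHalfPlaneSet R.carrier) (x : Fin 4 → ℝ), R.IsUniformizing φ x → ∀ᶠ δ in nhdsWithin (0 : ℝ) (Set.Ioi 0), |P (S t '' R.carrier) δ (S t '' R.arc 0) (S t '' R.arc 2) - Literature.Probability.RandomPlanarGeometry.cardyFunction (Literature.Probability.RandomPlanarGeometry.crossRatio x)| ≤ ε) → ∃ t : ℝ, ∀ R : Literature.Probability.RandomPlanarGeometry.ConformalRectangle, R.HasCrossingLimit (fun δ ↦ P (S t '' R.carrier) δ (S t '' R.arc 0) (S t '' R.arc 2)) Literature.Probability.RandomPlanarGeometry.cardyFunction := by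
  intro P S hS T happrox
  -- (1) stretches `t n ∈ [-T, T]` good at level `1 / (n + 1)`
  choose t ht_mem ht using fun n : ℕ ↦ happrox (1 / ((n : ℝ) + 1)) (by positivity)
  -- (2) Bolzano–Weierstrass: `t (φs n) → t⋆`
  obtain ⟨tstar, -, φs, hφs, hlim⟩ := isCompact_Icc.tendsto_subseq ht_mem
  refine ⟨tstar, fun R ↦ ?_⟩
  intro φ' x hux
  -- (3) the corrections `s n = t⋆ - t (φs n) → 0` and the image rectangles `R_n = S_{s n}(R)`
  have hs : Tendsto (fun n ↦ tstar - t (φs n)) atTop (𝓝 0) := by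
    have h : Tendsto (fun n ↦ tstar - (t ∘ φs) n) atTop (𝓝 (tstar - tstar)) :=
      tendsto_const_nhds.sub hlim
    rw [sub_self] at h
    exact h
  choose h hh using fun n ↦ Exact.exists_stretchHomeomorph S hS (tstar - t (φs n))
  obtain ⟨h₀, hh₀⟩ := Exact.exists_stretchHomeomorph S hS 0
  -- uniformizing data of the image rectangles
  choose ψ y hψ using fun n ↦ MarkedDomain.exists_isUniformizing_holds (R.map (h n))
  -- the hypothesis at `(t (φs n), R_n)`: the SAME numbers `P (S_{t⋆} R) δ`, target `F (η (R_n))`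
  have hlimn : ∀ n, ∀ᶠ δ in 𝓝[>] (0 : ℝ),
      |P (S tstar '' R.carrier) δ (S tstar '' R.arc 0) (S tstar '' R.arc 2) -
        cardyFunction (crossRatio (y n))| ≤ 1 / ((φs n : ℝ) + 1) := fun n ↦ by
    have key := ht (φs n) (R.map (h n)) (ψ n) (y n) (hψ n)
    have e : t (φs n) + (tstar - t (φs n)) = tstar := by ring
    rw [Exact.image_carrier_map_stretch S hS R (hh n), Exact.image_arc_map_stretch S hS R (hh n),
      Exact.image_arc_map_stretch S hS R (hh n), e] at key
    exact key
  -- (4) Radó: the cross-ratios of `R_n` converge to that of `R`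
  have hJ : TendstoUniformly (fun n ↦ (R.map (h n)).boundary) R.boundary atTop := by
    have hJ' := Exact.tendstoUniformly_boundary_map_stretch S hS R hs hh hh₀
    rwa [Exact.boundary_map_stretch_zero S hS R hh₀] at hJ'
  have hpt : ∀ i, Tendsto (fun n ↦ (R.map (h n)).pt i) atTop (𝓝 (R.pt i)) := fun i ↦ by
    have hp := Exact.tendsto_pt_map_stretch S hS R hs hh hh₀ i
    rwa [Exact.pt_map_stretch_zero S hS R hh₀] at hp
  have hcr : Tendsto (fun n ↦ crossRatio (y n)) atTop (𝓝 (crossRatio x)) :=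
    ConformalRectangle.tendsto_crossRatio_of_tendstoUniformly hJ hpt ψ y hψ φ' x hux
  -- (5) `F` is continuous at `crossRatio x ∈ (0, 1)`
  have hxI : crossRatio x ∈ Ioo (0 : ℝ) 1 :=
    ConformalRectangle.crossRatio_mem_Ioo_of_isUniformizing hux
  have hF : Tendsto (fun n ↦ cardyFunction (crossRatio (y n))) atTop
      (𝓝 (cardyFunction (crossRatio x))) :=
    (continuousOn_cardyFunction_Ioo.continuousAt (Ioo_mem_nhds hxI.1 hxI.2)).tendsto.comp hcr
  have hεn : Tendsto (fun n ↦ 1 / ((φs n : ℝ) + 1)) atTop (𝓝 0) :=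
    tendsto_one_div_add_atTop_nhds_zero_nat.comp hφs.tendsto_atTop
  -- (6) the `ε / 2 + ε / 2` argument
  rw [Metric.tendsto_nhds]
  intro ε hε
  have hε2 : 0 < ε / 2 := half_pos hε
  obtain ⟨n, hn1, hn2⟩ :=
    ((Metric.tendsto_nhds.1 hF (ε / 2) hε2).and ((tendsto_order.1 hεn).2 (ε / 2) hε2)).exists
  filter_upwards [hlimn n] with δ hδ
  rw [Real.dist_eq]
  calc |P (S tstar '' R.carrier) δ (S tstar '' R.arc 0) (S tstar '' R.arc 2) - cardyFunction (crossRatio x)|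
      ≤ |P (S tstar '' R.carrier) δ (S tstar '' R.arc 0) (S tstar '' R.arc 2) -
            cardyFunction (crossRatio (y n))| +
          dist (cardyFunction (crossRatio (y n))) (cardyFunction (crossRatio x)) := by
        rw [Real.dist_eq]
        exact abs_sub_le _ _ _
    _ < ε / 2 + ε / 2 := add_lt_add (hδ.trans_lt hn2) hn1
    _ = ε := add_halves ε

end Summit.CriticalPhenomena.CardyFormulaZ2.Cruxes.SegmentTransport.Birth

end
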